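import Literature.AlgebraicGeometry.HodgeTheory.BettiKunnethPieceCorrespondenceRepresentationRank
import Literature.AlgebraicGeometry.HodgeTheory.BettiHodgeConjectureProductNoExceptionalClasses
import HarnessLib

/-!
# `HC(S × Z)` for a REGULAR smooth projective surface (`q(S) = 0`) times an `n`-fold with `HC(Z)` iff the morphisms of Hodge structures `H²(S) → Hʲ(Z)(j/2 − 1)` (`j` even, `2 ≤ j ≤ n`) are accounted
# for by algebraic correspondences; `S × X` for a fourfold: `HC(S × X) ⟺ dim_ℚ Hom_HS(H²S, H²X) ≤ dim_ℂ ⟨algebraic actions H⁶(X;ℂ) → H²(S;ℂ)⟩ ∧ dim_ℚ Hom_HS(H²S, H⁴X(1)) ≤ dim_ℂ ⟨algebraic actions H⁴(X;ℂ) → H²(S;ℂ)⟩`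
# (Voisin I §11.3.3 Thm. 11.38–11.40, Lemma 11.41, p. 287, §6.2.3 Thm. 6.25, §11.3.1 Thm. 11.30; Voisin II (10.7); Voisin 2025 §3.2.1; Deligne 2000 §1)

Family `hodge`, lane `lit-hodgefound` (Track 2 foundations library; Layers A1/A4), layer `Literature/AlgebraicGeometry/HodgeTheory`.  THEOREMS ONLY (no definition, no named fact, no instance;
D-0026 net debt `0`).  The seat's g30-#3/#4 decide `HC(Y × Z)` by algebraic correspondences when the factor `Y` is OFF-MIDDLE ALGEBRAIC: `b_k(Y) = 0` for odd `k ≠ dim Y` and `Hdgᵇ(H^{2b}Y) = H^{2b}(Y;ℚ)` for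
`2b ≠ dim Y`.  §1 records that a REGULAR surface `S` (`q(S) = h^{1,0}(S) = 0`: K3 surfaces, Enriques surfaces, regular surfaces of general type, complete-intersection surfaces, …) is such a factor: its odd
Betti numbers vanish, `H⁰(S)` and `H⁴(S)` are pure and `H^{2b}(S) = 0` for `b ≥ 3` — with NO hypothesis on `p_g(S)`, i.e. with `H²(S)` of arbitrary transcendental part.  §2 reads g30-#3/#4 on `S × Z`
for an `n`-fold `Z` satisfying `HC(Z)`: the pieces to decide are `H²(S) ⊗ Hʲ(Z) ⊂ H^{2+j}(S × Z)`, `j` even, `2 ≤ j ≤ n`, whose Hodge classes are (Lemma 11.41) the morphisms of Hodge structures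
`H²(S) → Hʲ(Z)(j/2 − 1)`, and **`HC(S × Z)` iff each of them acts on `H^{2n−j}(Z;ℂ)` as some rational algebraic class of `H^{2+j}(S × Z)` does, iff `dim_ℚ Hdg(H²S ⊗ HʲZ) ≤ dim_ℂ ⟨algebraic actions
H^{2n−j}(Z;ℂ) → H²(S;ℂ)⟩` for each such `j`**.  §3 spells this out for a smooth projective FOURFOLD `X` with `HC(X)` (two pieces: `H²S ⊗ H²X ⊂ H⁴`, `H²S ⊗ H⁴X ⊂ H⁶`) together with the family
form (enough algebraic correspondences with independent actions ⇒ `HC(S × X)`).  For a threefold `T` the reading `HC(S × T) ⟺ dim_ℚ Hom_HS(H²S, H²T) ≤ dim_ℂ ⟨algebraic actions H⁴(T;ℂ) → H²(S;ℂ)⟩`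
is the case `Hom_HS(H¹S, H³T(1)) = 0` (automatic for `q(S) = 0`) of the seat's g30-#5 `…surface_tensor_threefold_iff_finrank_hom_le_finrank_span_of_hom_one_three` and is not restated.

WHAT IS PROVED.
* §1 **`BettiUniverse.hodgeClasses_hodge_eq_top_surface_of_ne_one`** (`Hdgᵇ(H^{2b}S) = ⊤` for `2b ≠ 2`, any surface), **`BettiUniverse.finrank_bettiCohomology_eq_zero_surface_of_q_zero_of_odd`**
  (`b_k(S) = 0`, `k` odd, in the «off-middle» shape).
* §2 (regular surface `S`, `n`-fold `Z` with `HC(Z)`) **`BettiUniverse.hodgeConjectureFor_regularSurface_tensor_iff_forall_exists_corrAction_eq`** (∃-form on the pieces `(2, j)`, `j` even, `2 ≤ j ≤ n`),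
  **`BettiUniverse.hodgeConjectureFor_regularSurface_tensor_iff_forall_finrank_le`** (numeric form), **`BettiUniverse.hodgeConjectureFor_regularSurface_tensor_iff_forall_finrank_hom_le`** (Hom form:
  `dim_ℚ Hom_HS(H²S, HʲZ(c − 2)) ≤ dim_ℂ ⟨algebraic actions⟩` for every even `2 ≤ j ≤ n`), **`BettiUniverse.kunneth_piece_regularSurface_algebraic_iff_finrank_le`** (one piece),
  **`BettiUniverse.kunneth_piece_regularSurface_algebraic_iff_exists_corrAction_eq`** (one piece, ∃-form).
* §3 (fourfold `X` with `HC(X)`) **`BettiUniverse.hodgeConjectureFor_regularSurface_tensor_fourfold_iff_finrank_hom_le_finrank_span`** (the two-piece criterion displayed in the title),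
  **`BettiUniverse.hodgeConjectureFor_regularSurface_tensor_fourfold_of_linearIndependent_corrAction`** (family form), **`BettiUniverse.hodgeConjectureFor_regularSurface_tensor_fourfold_iff_forall_exists_corrAction_eq`**
  (∃-form on the two pieces).

THE PRINTS.  C. Voisin (2002) [VoisinHodgeI2002] §6.2.3 Thm. 6.25; §7.1.2; §11.1.2 Prop. 11.20; §11.3.1 Thm. 11.30; §11.3.3 Thm. 11.38–11.40, Lemma 11.41 and pp. 286–287.  C. Voisin (2003) [VoisinHodgeII2003] §10.2.2 proof
of Thm. 10.17, (10.7); §11.1.1.  C. Voisin (2025) [Voisin2025] §3.2.1 (12)–(14), Prop. 3.8, Cor. 3.9.  P. Deligne (2000/2006) [Deligne2000] §1.  A. Hatcher (2002) [HatcherAT2002] §3.3 Thm. 3.26.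

THE OBJECTS (all the tree's).  `corrAction μ hY hZ hab`, `BettiUniverse.crossMap`, `BettiUniverse.kunnethSummand`, `BettiUniverse.hodge hHD hX k`, `hodgeNumber`, `hodgeClasses`, `HodgeStructure.Hom`, `tensor`,
`tateTwist`, `cast`, `bettiCohomology`, `complexBetti`, `ofRatClass`, `algebraicClasses`, `HodgeConjectureFor`; `hodgeConjectureFor_of_dim_le_three_holds` (`HC` in dimension `≤ 3`, tree theorem).

DEVIATIONS / SCOPE.  `HC(Z)` (resp. `HC(X)`) is a hypothesis; which algebraic correspondences `S ⊢ Z` exist is the geometry of the pair and is not discussed.  Irregular surfaces (`q > 0`) are not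
off-middle algebraic (`H¹`, `H³ ≠ 0`) and are not treated here (two arbitrary surfaces: the seat's g30-#5).  No definitions.

## References
* [VoisinHodgeI2002] C. Voisin, *Hodge Theory and Complex Algebraic Geometry I* (2002) — §6.2.3 Thm. 6.25; §7.1.2; §11.1.2 Prop. 11.20; §11.3.1 Thm. 11.30; §11.3.3 Thm. 11.38, Thm. 11.40, Lemma 11.41, pp. 286–287.
* [VoisinHodgeII2003] C. Voisin, *Hodge Theory and Complex Algebraic Geometry II* (2003) — §10.2.2 proof of Thm. 10.17 (10.7); §11.1.1.
* [Voisin2025] C. Voisin, *Cycle classes on algebraic varieties* (2025) — §3.2.1 (12)–(14), Prop. 3.8, Cor. 3.9.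
* [Deligne2000] P. Deligne, *The Hodge conjecture* (Clay problem description) — §1.
* [HatcherAT2002] A. Hatcher, *Algebraic Topology* (2002) — §3.3 Thm. 3.26.

## Provenance
Lane `lit-hodgefound` (Hodge path, Track 2), prover seat `lit-hodgefound-p29` (generation 30), self-proposed row g30-#8 (g30-#3/#4 LEFT read with `Y` a regular surface).
-/

noncomputable section

open scoped TensorProduct
open CategoryTheory MonoidalCategory CartesianMonoidalCategory Module Finset
open Literature.AlgebraicTopology.SingularHomology
open Literature.Geometry.Kaehler

namespace Literature.AlgebraicGeometry.HodgeTheory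

open Literature.AlgebraicGeometry.Motives
open Literature.AlgebraicGeometry.Motives.HodgeStructure

variable {n d : ℕ} {S X Z : SchemeOver ℂ}

/-! ### §1 A regular surface is off-middle algebraic -/

/-- **`Hdgᵇ(H^{2b}(S)) = H^{2b}(S;ℚ)` for `2b ≠ 2`**, `S` any smooth projective surface: `H⁰ = H^{0,0}`, `H⁴ = H^{2,2}` (points and the fundamental class) and `H^{2b} = 0` for `b ≥ 3`.
[cite: VoisinHodgeI2002, §7.1.2, §11.3.1 Thm. 11.30] [cite: HatcherAT2002, §3.3 Thm. 3.26] -/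
theorem BettiUniverse.hodgeClasses_hodge_eq_top_surface_of_ne_one [HodgeTensorFacts.{0, 0}] (hHD : exists_isReal_hodgeModel) (hS : IsSmoothProjective 2 S) (b : ℕ) (hb : 2 * b ≠ 2) :
    (BettiUniverse.hodge hHD hS (2 * b)).hodgeClasses b = ⊤ := by
  rcases Nat.lt_or_ge b 3 with hb3 | hb3
  · rcases (show b = 0 ∨ b = 2 by omega) with rfl | rfl
    · exact BettiUniverse.hodgeClasses_hodge_zero_eq_top hHD hS
    · exact BettiUniverse.hodgeClasses_hodge_top_eq_top hHD hS
  · haveI := BettiUniverse.finite hS (2 * b)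
    haveI : Subsingleton (bettiCohomology S (2 * b)) := Module.finrank_zero_iff.1 (BettiUniverse.finrank_bettiCohomology_eq_zero_of_lt hS (by omega))
    exact eq_top_iff.2 fun v _ ↦ by rw [Subsingleton.elim v 0]; exact Submodule.zero_mem _

/-- **`b_k(S) = 0` for `k` odd when `q(S) = h^{1,0}(S) = 0`** (`b₁ = b₃ = 2q`, `Hᵏ = 0` for `k ≥ 5`), in the «off-middle» shape of the seat's g30-#3/#4 (the condition `k ≠ 2` is void for odd `k`).
[cite: VoisinHodgeI2002, §6.2.3 Thm. 6.25, §7.1.2] -/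
theorem BettiUniverse.finrank_bettiCohomology_eq_zero_surface_of_q_zero_of_odd [HodgeTensorFacts.{0, 0}] (hHD : exists_isReal_hodgeModel) (hS : IsSmoothProjective 2 S)
    (h10 : (BettiUniverse.hodge hHD hS 1).hodgeNumber 1 0 = 0) (k : ℕ) (hk : Odd k) (_hk2 : k ≠ 2) : Module.finrank ℚ (bettiCohomology S k) = 0 :=
  BettiUniverse.finrank_bettiCohomology_odd_eq_zero_surface_of_q_zero hHD hS h10 hk

section Pieces

variable [HodgeTensorFacts.{0, 0}] (μ : OrientationFamily)

/-! ### §2 `HC(S × Z)` on the pieces `H²(S) ⊗ Hʲ(Z)`, `j` even, `2 ≤ j ≤ dim Z` -/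

/-- **`HC(S × Z)` IFF every Hodge class of every piece `H²(S) ⊗ Hʲ(Z)`, `j` even, `2 ≤ j ≤ n`, acts on `H^{2n−j}(Z;ℂ)` as some rational algebraic class of `H^{2+j}(S × Z)` does** (`S` a regular smooth
projective surface, `Z` an `n`-fold with `HC(Z)`; `2 + j = 2c` forces `j` even; by Lemma 11.41 the Hodge classes of `H²(S) ⊗ Hʲ(Z)` are the morphisms of Hodge structures `H²(S) → Hʲ(Z)(c − 2)`).
[cite: VoisinHodgeI2002, §11.3.3 Thm. 11.38–11.40, Lemma 11.41 and pp. 286–287, §11.3.1 Thm. 11.30] [cite: Voisin2025, §3.2.1 (12)–(14), Prop. 3.8 and Cor. 3.9] [cite: Deligne2000, §1] -/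
theorem BettiUniverse.hodgeConjectureFor_regularSurface_tensor_iff_forall_exists_corrAction_eq (hHD : exists_isReal_hodgeModel) (hS : IsSmoothProjective 2 S) (hZ : IsSmoothProjective n Z)
    (hSZ : IsSmoothProjective d (S ⊗ Z)) (hHCZ : HodgeConjectureFor n Z) (h10 : (BettiUniverse.hodge hHD hS 1).hodgeNumber 1 0 = 0) :
    HodgeConjectureFor d (S ⊗ Z) ↔
      ∀ (c j a : ℕ) (hj : 2 + j = 2 * c) (hab : a + 2 * c = 2 + 2 * n), 2 ≤ j → j ≤ n →
        ∀ t ∈ (BettiUniverse.kunnethSummand hHD hS hZ (2 * c) ⟨(2, j), HasAntidiagonal.mem_antidiagonal.2 hj⟩).hodgeClasses c,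
          ∃ γ : bettiCohomology (S ⊗ Z) (2 * c), ofRatClass (ComplexPoints (S ⊗ Z)) (2 * c) γ ∈ algebraicClasses (S ⊗ Z) c ∧
            corrAction μ hS hZ hab (ofRatClass (ComplexPoints (S ⊗ Z)) (2 * c) γ) = corrAction μ hS hZ hab (ofRatClass (ComplexPoints (S ⊗ Z)) (2 * c) (BettiUniverse.crossMap S Z hj t)) := by
  have hHCS : HodgeConjectureFor 2 S := hodgeConjectureFor_of_dim_le_three_holds (by norm_num) hS
  rw [BettiUniverse.hodgeConjectureFor_tensor_iff_forall_exists_corrAction_eq_left μ hHD hS hZ hSZ hHCS hHCZ (BettiUniverse.finrank_bettiCohomology_eq_zero_surface_of_q_zero_of_odd hHD hS h10)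
    (BettiUniverse.hodgeClasses_hodge_eq_top_surface_of_ne_one hHD hS)]
  exact ⟨fun h c j a hj hab _ hjn t ht ↦ h c j a hj hab (by omega) hjn t ht, fun h c j a hj hab _ hjn t ht ↦ h c j a hj hab (by omega) hjn t ht⟩

/-- **NUMERIC FORM: `HC(S × Z) ⟺` for every even `j` with `2 ≤ j ≤ n`: `dim_ℚ Hdgᶜ(H²S ⊗ HʲZ) ≤ dim_ℂ ⟨actions on H^{2n−j}(Z;ℂ) of the rational algebraic classes of H^{2+j}(S × Z)⟩`** (`2c = 2 + j`;
`dim_ℚ Hdgᶜ(H²S ⊗ HʲZ) = dim_ℚ Hom_HS(H²S, HʲZ(c − 2))` by Lemma 11.41; the right side is at most the left side, g30-#4). [cite: VoisinHodgeI2002, §11.3.3 Thm. 11.38–11.40, Lemma 11.41 and pp. 286–287]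
[cite: Voisin2025, §3.2.1 (12)–(14), Prop. 3.8 and Cor. 3.9] [cite: Deligne2000, §1] -/
theorem BettiUniverse.hodgeConjectureFor_regularSurface_tensor_iff_forall_finrank_le (hHD : exists_isReal_hodgeModel) (hS : IsSmoothProjective 2 S) (hZ : IsSmoothProjective n Z)
    (hSZ : IsSmoothProjective d (S ⊗ Z)) (hHCZ : HodgeConjectureFor n Z) (h10 : (BettiUniverse.hodge hHD hS 1).hodgeNumber 1 0 = 0) :
    HodgeConjectureFor d (S ⊗ Z) ↔
      ∀ (c j a : ℕ) (_hj : 2 + j = 2 * c) (hab : a + 2 * c = 2 + 2 * n), 2 ≤ j → j ≤ n →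
        Module.finrank ℚ ↥(((BettiUniverse.hodge hHD hS 2).tensor (BettiUniverse.hodge hHD hZ j)).hodgeClasses c) ≤
          Module.finrank ℂ ↥(Submodule.span ℂ ((fun γ ↦ corrAction μ hS hZ hab (ofRatClass (ComplexPoints (S ⊗ Z)) (2 * c) γ)) ''
            {γ : bettiCohomology (S ⊗ Z) (2 * c) | ofRatClass (ComplexPoints (S ⊗ Z)) (2 * c) γ ∈ algebraicClasses (S ⊗ Z) c})) := by
  have hHCS : HodgeConjectureFor 2 S := hodgeConjectureFor_of_dim_le_three_holds (by norm_num) hS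
  rw [BettiUniverse.hodgeConjectureFor_tensor_iff_forall_finrank_le_left μ hHD hS hZ hSZ hHCS hHCZ (BettiUniverse.finrank_bettiCohomology_eq_zero_surface_of_q_zero_of_odd hHD hS h10)
    (BettiUniverse.hodgeClasses_hodge_eq_top_surface_of_ne_one hHD hS)]
  exact ⟨fun h c j a hj hab _ hjn ↦ h c j a hj hab (by omega) hjn, fun h c j a hj hab _ hjn ↦ h c j a hj hab (by omega) hjn⟩

/-- **HOM FORM: `HC(S × Z) ⟺` for every even `j` with `2 ≤ j ≤ n`: `dim_ℚ Hom_HS(H²(S), Hʲ(Z)(c − 2)) ≤ dim_ℂ ⟨actions on H^{2n−j}(Z;ℂ) of the rational algebraic classes of H^{2+j}(S × Z)⟩`** (`2c = 2 + j`):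
the morphisms of Hodge structures `H²(S) → Hʲ(Z)(j/2 − 1)` must be accounted for, in action, by algebraic correspondences. [cite: VoisinHodgeI2002, §11.3.3 Thm. 11.38–11.40, Lemma 11.41 and pp. 286–287]
[cite: Voisin2025, §3.2.1 (12)–(14), Prop. 3.8 and Cor. 3.9] [cite: Deligne2000, §1] -/
theorem BettiUniverse.hodgeConjectureFor_regularSurface_tensor_iff_forall_finrank_hom_le (hHD : exists_isReal_hodgeModel) (hS : IsSmoothProjective 2 S) (hZ : IsSmoothProjective n Z)
    (hSZ : IsSmoothProjective d (S ⊗ Z)) (hHCZ : HodgeConjectureFor n Z) (h10 : (BettiUniverse.hodge hHD hS 1).hodgeNumber 1 0 = 0) :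
    HodgeConjectureFor d (S ⊗ Z) ↔
      ∀ (c j a : ℕ) (hj : 2 + j = 2 * c) (hab : a + 2 * c = 2 + 2 * n), 2 ≤ j → j ≤ n →
        Module.finrank ℚ (HodgeStructure.Hom (BettiUniverse.hodge hHD hS 2) (((BettiUniverse.hodge hHD hZ j).tateTwist ((c : ℤ) - 2)).cast (by omega))) ≤
          Module.finrank ℂ ↥(Submodule.span ℂ ((fun γ ↦ corrAction μ hS hZ hab (ofRatClass (ComplexPoints (S ⊗ Z)) (2 * c) γ)) ''
            {γ : bettiCohomology (S ⊗ Z) (2 * c) | ofRatClass (ComplexPoints (S ⊗ Z)) (2 * c) γ ∈ algebraicClasses (S ⊗ Z) c})) := by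
  rw [BettiUniverse.hodgeConjectureFor_regularSurface_tensor_iff_forall_finrank_le μ hHD hS hZ hSZ hHCZ h10]
  refine forall_congr' fun c ↦ forall_congr' fun j ↦ forall_congr' fun a ↦ forall_congr' fun hj ↦ forall_congr' fun hab ↦ forall_congr' fun _ ↦ forall_congr' fun _ ↦ ?_
  have e := BettiUniverse.finrank_hodgeClasses_tensor_hodge_eq_finrank_hom_tateTwist hHD hS hZ 2 j (s := (c : ℤ) - 2) (by omega)
  rw [show (((2 : ℕ) : ℤ) + ((c : ℤ) - 2)) = ((c : ℕ) : ℤ) by ring] at e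
  rw [e]

/-- **One piece, numeric form**: for a regular surface `S` and an `n`-fold `Z` with `HC(Z)`, the piece `H²(S) ⊗ Hʲ(Z)` of `H^{2c}(S × Z)` is algebraic iff `dim_ℚ Hdgᶜ(H²S ⊗ HʲZ) ≤ dim_ℂ ⟨actions on
H^{2n−j}(Z;ℂ) of the rational algebraic classes of H^{2c}(S × Z)⟩`. [cite: VoisinHodgeI2002, §11.3.3 Thm. 11.38–11.40, Lemma 11.41 and pp. 286–287] [cite: Voisin2025, §3.2.1 (12)–(14), Prop. 3.8 and Cor. 3.9] -/
theorem BettiUniverse.kunneth_piece_regularSurface_algebraic_iff_finrank_le (hHD : exists_isReal_hodgeModel) (hS : IsSmoothProjective 2 S) (hZ : IsSmoothProjective n Z)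
    (hHCZ : HodgeConjectureFor n Z) (h10 : (BettiUniverse.hodge hHD hS 1).hodgeNumber 1 0 = 0) {c j a : ℕ} (hj : 2 + j = 2 * c) (haj : a + j = 2 * n) (hab : a + 2 * c = 2 + 2 * n) :
    (∀ t ∈ (BettiUniverse.kunnethSummand hHD hS hZ (2 * c) ⟨(2, j), HasAntidiagonal.mem_antidiagonal.2 hj⟩).hodgeClasses c,
        ofRatClass (ComplexPoints (S ⊗ Z)) (2 * c) (BettiUniverse.crossMap S Z hj t) ∈ algebraicClasses (S ⊗ Z) c) ↔
      Module.finrank ℚ ↥(((BettiUniverse.hodge hHD hS 2).tensor (BettiUniverse.hodge hHD hZ j)).hodgeClasses c) ≤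
        Module.finrank ℂ ↥(Submodule.span ℂ ((fun γ ↦ corrAction μ hS hZ hab (ofRatClass (ComplexPoints (S ⊗ Z)) (2 * c) γ)) ''
          {γ : bettiCohomology (S ⊗ Z) (2 * c) | ofRatClass (ComplexPoints (S ⊗ Z)) (2 * c) γ ∈ algebraicClasses (S ⊗ Z) c})) :=
  BettiUniverse.kunneth_piece_algebraic_iff_finrank_le_left μ hHD hS hZ (hodgeConjectureFor_of_dim_le_three_holds (by norm_num) hS) hHCZ
    (BettiUniverse.finrank_bettiCohomology_eq_zero_surface_of_q_zero_of_odd hHD hS h10) (BettiUniverse.hodgeClasses_hodge_eq_top_surface_of_ne_one hHD hS) hj haj hab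

/-- **One piece, ∃-form**: for a regular surface `S` and an `n`-fold `Z` with `HC(Z)`, the piece `H²(S) ⊗ Hʲ(Z)` of `H^{2c}(S × Z)` is algebraic iff each of its Hodge classes acts on `H^{2n−j}(Z;ℂ)` as
some rational algebraic class of `H^{2c}(S × Z)` does. [cite: VoisinHodgeI2002, §11.1.2 Prop. 11.20, §11.3.3 Thm. 11.38–11.40, Lemma 11.41 and pp. 286–287] [cite: Voisin2025, §3.2.1 (12)–(14), Prop. 3.8 and Cor. 3.9] -/
theorem BettiUniverse.kunneth_piece_regularSurface_algebraic_iff_exists_corrAction_eq (hHD : exists_isReal_hodgeModel) (hS : IsSmoothProjective 2 S) (hZ : IsSmoothProjective n Z)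
    (hHCZ : HodgeConjectureFor n Z) (h10 : (BettiUniverse.hodge hHD hS 1).hodgeNumber 1 0 = 0) {c j a : ℕ} (hj : 2 + j = 2 * c) (haj : a + j = 2 * n) (hab : a + 2 * c = 2 + 2 * n) :
    (∀ t ∈ (BettiUniverse.kunnethSummand hHD hS hZ (2 * c) ⟨(2, j), HasAntidiagonal.mem_antidiagonal.2 hj⟩).hodgeClasses c,
        ofRatClass (ComplexPoints (S ⊗ Z)) (2 * c) (BettiUniverse.crossMap S Z hj t) ∈ algebraicClasses (S ⊗ Z) c) ↔
      ∀ t ∈ (BettiUniverse.kunnethSummand hHD hS hZ (2 * c) ⟨(2, j), HasAntidiagonal.mem_antidiagonal.2 hj⟩).hodgeClasses c,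
        ∃ γ : bettiCohomology (S ⊗ Z) (2 * c), ofRatClass (ComplexPoints (S ⊗ Z)) (2 * c) γ ∈ algebraicClasses (S ⊗ Z) c ∧
          corrAction μ hS hZ hab (ofRatClass (ComplexPoints (S ⊗ Z)) (2 * c) γ) = corrAction μ hS hZ hab (ofRatClass (ComplexPoints (S ⊗ Z)) (2 * c) (BettiUniverse.crossMap S Z hj t)) := by
  refine ⟨fun h t ht ↦ ⟨_, h t ht, rfl⟩, fun h t ht ↦ ?_⟩
  obtain ⟨γ, hγ, hact⟩ := h t ht
  exact BettiUniverse.ofRatClass_crossMap_mem_algebraicClasses_of_corrAction_eq_left μ hHD hS hZ (hodgeConjectureFor_of_dim_le_three_holds (by norm_num) hS) hHCZ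
    (BettiUniverse.finrank_bettiCohomology_eq_zero_surface_of_q_zero_of_odd hHD hS h10) (BettiUniverse.hodgeClasses_hodge_eq_top_surface_of_ne_one hHD hS) hj haj hab hγ hact

/-! ### §3 A regular surface times a fourfold -/

/-- **`S × X` for a regular surface `S` and a smooth projective FOURFOLD `X` satisfying `HC(X)`: `HC(S × X) ⟺ [dim_ℚ Hom_HS(H²S, H²X) ≤ dim_ℂ ⟨actions H⁶(X;ℂ) → H²(S;ℂ) of the rational algebraic
classes of H⁴(S × X)⟩] ∧ [dim_ℚ Hom_HS(H²S, H⁴X(1)) ≤ dim_ℂ ⟨actions H⁴(X;ℂ) → H²(S;ℂ) of the rational algebraic classes of H⁶(S × X)⟩]`** (the even `j` with `2 ≤ j ≤ 4` are `2` and `4`).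
[cite: VoisinHodgeI2002, §11.3.3 Thm. 11.38–11.40, Lemma 11.41 and pp. 286–287] [cite: Voisin2025, §3.2.1 (12)–(14), Prop. 3.8 and Cor. 3.9] [cite: Deligne2000, §1] -/
theorem BettiUniverse.hodgeConjectureFor_regularSurface_tensor_fourfold_iff_finrank_hom_le_finrank_span (hHD : exists_isReal_hodgeModel) (hS : IsSmoothProjective 2 S)
    (hX : IsSmoothProjective 4 X) (hSX : IsSmoothProjective d (S ⊗ X)) (hHCX : HodgeConjectureFor 4 X) (h10 : (BettiUniverse.hodge hHD hS 1).hodgeNumber 1 0 = 0) :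
    HodgeConjectureFor d (S ⊗ X) ↔
      Module.finrank ℚ (HodgeStructure.Hom (BettiUniverse.hodge hHD hS 2) (BettiUniverse.hodge hHD hX 2)) ≤
          Module.finrank ℂ ↥(Submodule.span ℂ ((fun γ ↦ corrAction μ hS hX (rfl : 6 + 2 * 2 = 2 + 2 * 4) (ofRatClass (ComplexPoints (S ⊗ X)) (2 * 2) γ)) ''
            {γ : bettiCohomology (S ⊗ X) (2 * 2) | ofRatClass (ComplexPoints (S ⊗ X)) (2 * 2) γ ∈ algebraicClasses (S ⊗ X) 2})) ∧
        Module.finrank ℚ (HodgeStructure.Hom (BettiUniverse.hodge hHD hS 2) (((BettiUniverse.hodge hHD hX 4).tateTwist 1).cast (by norm_num))) ≤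
          Module.finrank ℂ ↥(Submodule.span ℂ ((fun γ ↦ corrAction μ hS hX (rfl : 4 + 2 * 3 = 2 + 2 * 4) (ofRatClass (ComplexPoints (S ⊗ X)) (2 * 3) γ)) ''
            {γ : bettiCohomology (S ⊗ X) (2 * 3) | ofRatClass (ComplexPoints (S ⊗ X)) (2 * 3) γ ∈ algebraicClasses (S ⊗ X) 3})) := by
  have e₂ := BettiUniverse.finrank_hodgeClasses_tensor_hodge_eq_finrank_hom hHD hS hX 2
  have e₄ := BettiUniverse.finrank_hodgeClasses_tensor_hodge_eq_finrank_hom_tateTwist hHD hS hX 2 4 (s := 1) (by norm_num)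
  rw [show (((2 : ℕ) : ℤ) + 1) = ((3 : ℕ) : ℤ) by norm_num] at e₄
  rw [← e₂, ← e₄, BettiUniverse.hodgeConjectureFor_regularSurface_tensor_iff_forall_finrank_le μ hHD hS hX hSX hHCX h10]
  refine ⟨fun h ↦ ⟨h 2 2 6 (by norm_num) rfl le_rfl (by norm_num), h 3 4 4 (by norm_num) rfl (by norm_num) le_rfl⟩, fun h c j a hj hab hj2 hjn ↦ ?_⟩
  rcases (show j = 2 ∨ j = 3 ∨ j = 4 by omega) with rfl | rfl | rfl
  · obtain rfl : c = 2 := by omega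
    obtain rfl : a = 6 := by omega
    exact h.1
  · exfalso
    omega
  · obtain rfl : c = 3 := by omega
    obtain rfl : a = 4 := by omega
    exact h.2

/-- **∃-form for `S × X`** (`S` regular, `X` a fourfold with `HC(X)`): `HC(S × X)` iff every Hodge class of `H²(S) ⊗ H²(X)` acts on `H⁶(X;ℂ)`, and every Hodge class of `H²(S) ⊗ H⁴(X)` acts on
`H⁴(X;ℂ)`, as some rational algebraic class of `H⁴(S × X)`, resp. `H⁶(S × X)`, does. [cite: VoisinHodgeI2002, §11.3.3 Thm. 11.38–11.40, Lemma 11.41 and pp. 286–287] [cite: Voisin2025, §3.2.1 (12)–(14), Prop. 3.8 and Cor. 3.9]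
[cite: Deligne2000, §1] -/
theorem BettiUniverse.hodgeConjectureFor_regularSurface_tensor_fourfold_iff_forall_exists_corrAction_eq (hHD : exists_isReal_hodgeModel) (hS : IsSmoothProjective 2 S)
    (hX : IsSmoothProjective 4 X) (hSX : IsSmoothProjective d (S ⊗ X)) (hHCX : HodgeConjectureFor 4 X) (h10 : (BettiUniverse.hodge hHD hS 1).hodgeNumber 1 0 = 0) :
    HodgeConjectureFor d (S ⊗ X) ↔
      (∀ t ∈ (BettiUniverse.kunnethSummand hHD hS hX (2 * 2) ⟨(2, 2), HasAntidiagonal.mem_antidiagonal.2 rfl⟩).hodgeClasses 2,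
        ∃ γ : bettiCohomology (S ⊗ X) (2 * 2), ofRatClass (ComplexPoints (S ⊗ X)) (2 * 2) γ ∈ algebraicClasses (S ⊗ X) 2 ∧
          corrAction μ hS hX (rfl : 6 + 2 * 2 = 2 + 2 * 4) (ofRatClass (ComplexPoints (S ⊗ X)) (2 * 2) γ) =
            corrAction μ hS hX (rfl : 6 + 2 * 2 = 2 + 2 * 4) (ofRatClass (ComplexPoints (S ⊗ X)) (2 * 2) (BettiUniverse.crossMap S X (show 2 + 2 = 2 * 2 by norm_num) t))) ∧
      (∀ t ∈ (BettiUniverse.kunnethSummand hHD hS hX (2 * 3) ⟨(2, 4), HasAntidiagonal.mem_antidiagonal.2 rfl⟩).hodgeClasses 3,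
        ∃ γ : bettiCohomology (S ⊗ X) (2 * 3), ofRatClass (ComplexPoints (S ⊗ X)) (2 * 3) γ ∈ algebraicClasses (S ⊗ X) 3 ∧
          corrAction μ hS hX (rfl : 4 + 2 * 3 = 2 + 2 * 4) (ofRatClass (ComplexPoints (S ⊗ X)) (2 * 3) γ) =
            corrAction μ hS hX (rfl : 4 + 2 * 3 = 2 + 2 * 4) (ofRatClass (ComplexPoints (S ⊗ X)) (2 * 3) (BettiUniverse.crossMap S X (show 2 + 4 = 2 * 3 by norm_num) t))) := by
  rw [BettiUniverse.hodgeConjectureFor_regularSurface_tensor_iff_forall_exists_corrAction_eq μ hHD hS hX hSX hHCX h10]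
  refine ⟨fun h ↦ ⟨fun t ht ↦ h 2 2 6 (by norm_num) rfl le_rfl (by norm_num) t ht, fun t ht ↦ h 3 4 4 (by norm_num) rfl (by norm_num) le_rfl t ht⟩,
    fun h c j a hj hab hj2 hjn t ht ↦ ?_⟩
  rcases (show j = 2 ∨ j = 3 ∨ j = 4 by omega) with rfl | rfl | rfl
  · obtain rfl : c = 2 := by omega
    obtain rfl : a = 6 := by omega
    exact h.1 t ht
  · exfalso
    omega
  · obtain rfl : c = 3 := by omega
    obtain rfl : a = 4 := by omega
    exact h.2 t ht

/-- **Family form for `S × X`** (`S` regular, `X` a fourfold with `HC(X)`): `|ι|` rational algebraic classes of `H⁴(S × X)` with ℂ-linearly independent actions `H⁶(X;ℂ) → H²(S;ℂ)`, `|κ|` rational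
algebraic classes of `H⁶(S × X)` with ℂ-linearly independent actions `H⁴(X;ℂ) → H²(S;ℂ)`, `dim_ℚ Hom_HS(H²S, H²X) ≤ |ι|` and `dim_ℚ Hom_HS(H²S, H⁴X(1)) ≤ |κ|` ⇒ `HC(S × X)`.
[cite: VoisinHodgeI2002, §11.3.3 Thm. 11.38–11.40, Lemma 11.41 and pp. 286–287] [cite: Voisin2025, §3.2.1 (12)–(14), Prop. 3.8 and Cor. 3.9] [cite: Deligne2000, §1] -/
theorem BettiUniverse.hodgeConjectureFor_regularSurface_tensor_fourfold_of_linearIndependent_corrAction {ι κ : Type} [Fintype ι] [Fintype κ] (hHD : exists_isReal_hodgeModel)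
    (hS : IsSmoothProjective 2 S) (hX : IsSmoothProjective 4 X) (hSX : IsSmoothProjective d (S ⊗ X)) (hHCX : HodgeConjectureFor 4 X) (h10 : (BettiUniverse.hodge hHD hS 1).hodgeNumber 1 0 = 0)
    (γ : ι → bettiCohomology (S ⊗ X) (2 * 2)) (hγ : ∀ k, ofRatClass (ComplexPoints (S ⊗ X)) (2 * 2) (γ k) ∈ algebraicClasses (S ⊗ X) 2)
    (hind : LinearIndependent ℂ fun k ↦ corrAction μ hS hX (rfl : 6 + 2 * 2 = 2 + 2 * 4) (ofRatClass (ComplexPoints (S ⊗ X)) (2 * 2) (γ k)))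
    (hHom : Module.finrank ℚ (HodgeStructure.Hom (BettiUniverse.hodge hHD hS 2) (BettiUniverse.hodge hHD hX 2)) ≤ Fintype.card ι)
    (δ : κ → bettiCohomology (S ⊗ X) (2 * 3)) (hδ : ∀ k, ofRatClass (ComplexPoints (S ⊗ X)) (2 * 3) (δ k) ∈ algebraicClasses (S ⊗ X) 3)
    (hind' : LinearIndependent ℂ fun k ↦ corrAction μ hS hX (rfl : 4 + 2 * 3 = 2 + 2 * 4) (ofRatClass (ComplexPoints (S ⊗ X)) (2 * 3) (δ k)))
    (hHom' : Module.finrank ℚ (HodgeStructure.Hom (BettiUniverse.hodge hHD hS 2) (((BettiUniverse.hodge hHD hX 4).tateTwist 1).cast (by norm_num))) ≤ Fintype.card κ) :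
    HodgeConjectureFor d (S ⊗ X) := by
  haveI := finite_complexBetti hX 6
  haveI := finite_complexBetti hX 4
  haveI := finite_complexBetti hS 2
  refine (BettiUniverse.hodgeConjectureFor_regularSurface_tensor_fourfold_iff_finrank_hom_le_finrank_span μ hHD hS hX hSX hHCX h10).2 ⟨hHom.trans ?_, hHom'.trans ?_⟩
  · have hsub : Submodule.span ℂ (Set.range fun k ↦ corrAction μ hS hX (rfl : 6 + 2 * 2 = 2 + 2 * 4) (ofRatClass (ComplexPoints (S ⊗ X)) (2 * 2) (γ k))) ≤
        Submodule.span ℂ ((fun γ ↦ corrAction μ hS hX (rfl : 6 + 2 * 2 = 2 + 2 * 4) (ofRatClass (ComplexPoints (S ⊗ X)) (2 * 2) γ)) ''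
          {γ : bettiCohomology (S ⊗ X) (2 * 2) | ofRatClass (ComplexPoints (S ⊗ X)) (2 * 2) γ ∈ algebraicClasses (S ⊗ X) 2}) :=
      Submodule.span_mono (Set.range_subset_iff.2 fun k ↦ ⟨γ k, hγ k, rfl⟩)
    refine le_trans ?_ (Submodule.finrank_mono hsub)
    rw [finrank_span_eq_card hind]
  · have hsub : Submodule.span ℂ (Set.range fun k ↦ corrAction μ hS hX (rfl : 4 + 2 * 3 = 2 + 2 * 4) (ofRatClass (ComplexPoints (S ⊗ X)) (2 * 3) (δ k))) ≤
        Submodule.span ℂ ((fun γ ↦ corrAction μ hS hX (rfl : 4 + 2 * 3 = 2 + 2 * 4) (ofRatClass (ComplexPoints (S ⊗ X)) (2 * 3) γ)) ''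
          {γ : bettiCohomology (S ⊗ X) (2 * 3) | ofRatClass (ComplexPoints (S ⊗ X)) (2 * 3) γ ∈ algebraicClasses (S ⊗ X) 3}) :=
      Submodule.span_mono (Set.range_subset_iff.2 fun k ↦ ⟨δ k, hδ k, rfl⟩)
    refine le_trans ?_ (Submodule.finrank_mono hsub)
    rw [finrank_span_eq_card hind']

end Pieces

end Literature.AlgebraicGeometry.HodgeTheory

end
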